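import Summits.Ventures.PercRepro.Defs
import Summits.Ventures.PercRepro.Conditioning
import Summits.Ventures.PercRepro.Graph
import Summits.Ventures.PercRepro.FlipConcavity
import Summits.Ventures.PercRepro.StrictFlip
import Summits.Ventures.PercRepro.Cell3
import Summits.Ventures.PercRepro.MinimalConfig

/-!
# The strict pair-sum inequality, part A (p6, gen 2; split for the 400-line lint)

Sections `Side` (`awayFrom`, `sideConfig`, `sideConfig_spec`) and `Endpoint` (`joinConfig`, `joinConfig_spec`,
`joinConfig_third_spec`). The negative pair and the strict bound are in `PairSumStrict.lean`, which imports this file.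
-/

namespace PercRepro

open Finset

variable {E : Type*}

namespace MultiGraph

variable {V : Type*} {G : MultiGraph V E}

/-! ### The side configurations of the internal case -/

section Side

variable [DecidableEq E]

omit [DecidableEq E] in
/-- Closed edges of a pointwise supremum. -/
theorem sup_apply_eq_false_iff (ω ω' : Config E) (e : E) :
    (ω ⊔ ω') e = false ↔ ω e = false ∧ ω' e = false := by
  simp [Pi.sup_apply]

omit [DecidableEq E] in
/-- An edge closed in `ω` is closed in any restriction of `ω`. -/
theorem restrictTo_eq_false_of_eq_false {ω : Config E} {e : E} (h : ω e = false) (X : Set V) :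
    G.restrictTo ω X e = false := by
  simp [restrictTo, h]

omit [DecidableEq E] in
/-- An edge with an endpoint outside `X` is closed in `restrictTo ω X`. -/
theorem restrictTo_eq_false_of_fst_notMem {ω : Config E} {e : E} {X : Set V}
    (h : G.fst e ∉ X) : G.restrictTo ω X e = false := by
  simp [restrictTo, h]

omit [DecidableEq E] in
/-- An edge whose second endpoint is outside `X` is closed in the restriction. -/
theorem restrictTo_eq_false_of_snd_notMem {ω : Config E} {e : E} {X : Set V}
    (h : G.snd e ∉ X) : G.restrictTo ω X e = false := by
  simp [restrictTo, h]

/-- Opening an edge `e = {w, v}` connects `w` and `v`. -/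
theorem conn_update_true_of_endpoints (ω : Config E) {e : E} {v w : V}
    (hend : (G.fst e = v ∧ G.snd e = w) ∨ (G.fst e = w ∧ G.snd e = v)) :
    G.Conn (Function.update ω e true) w v :=
  Conn.of_openAdj ⟨e, by simp, hend.symm⟩

/-- `P` with all edges at `w` closed. -/
noncomputable def awayFrom (G : MultiGraph V E) (P : Config E) (w : V) : Config E :=
  G.restrictTo P {x | x ≠ w}

omit [DecidableEq E] in
/-- `awayFrom` is pointwise below the configuration (it is a restriction). -/
theorem awayFrom_le (P : Config E) (w : V) : G.awayFrom P w ≤ P := restrictTo_le P _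

omit [DecidableEq E] in
/-- No open edge of `awayFrom P w` touches `w`. -/
theorem awayFrom_no_edge (P : Config E) (w : V) :
    ∀ g, G.awayFrom P w g = true → G.fst g ≠ w ∧ G.snd g ≠ w := by
  intro g hg
  rw [awayFrom, restrictTo_eq_true_iff] at hg
  exact ⟨hg.2.1, hg.2.2⟩

omit [DecidableEq E] in
/-- Open edges of `awayFrom P w` are open edges of `P` not touching `w`, and conversely. -/
theorem awayFrom_eq_true_iff {P : Config E} {w : V} {g : E} :
    G.awayFrom P w g = true ↔ P g = true ∧ G.fst g ≠ w ∧ G.snd g ≠ w := by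
  rw [awayFrom, restrictTo_eq_true_iff]
  rfl

/-- The side configuration: the edges of `P` on the side of `u` when the edges at `w` are cut,
together with the edge(s) of `P` joining that side to `w`, plus the `c`-cluster of `Q'`. -/
noncomputable def sideConfig (G : MultiGraph V E) (P Q' : Config E) (u w c : V) : Config E :=
  G.restrictTo P (G.cluster (G.awayFrom P w) u ∪ {w}) ⊔ G.restrictTo Q' (G.cluster Q' c)

/-- **The internal case.**  Let `P` be a minimal configuration with `u ↔ u'`, `u ↮ c`; `w` a
vertex of the cluster of `u` different from `u, u'`; `Q'` a configuration whose `c`-cluster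
avoids the cluster of `u` in `P` and contains `v`; and `e = {v, w}` closed in both.  Then in the
side configuration `η` of `u`: `e` is closed, `u'` is isolated (also after opening `e`), `u ↮ c`,
and after opening `e`, `u ↔ c`. -/
theorem sideConfig_spec {P Q' : Config E} {u u' w v c : V} {e : E}
    (hPuu' : G.Conn P u u') (hPmin : ∀ g, P g = true → ¬ G.Conn (Function.update P g false) u u')
    (hPuc : ¬ G.Conn P u c) (hw : G.Conn P u w) (hwu : w ≠ u) (hwu' : w ≠ u')
    (hCW : ∀ y, G.Conn Q' c y → ¬ G.Conn P u y) (hcv : G.Conn Q' c v) (hQ'e : Q' e = false)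
    (hPe : P e = false) (hend : (G.fst e = v ∧ G.snd e = w) ∨ (G.fst e = w ∧ G.snd e = v)) :
    G.sideConfig P Q' u w c e = false ∧
      (∀ g, G.sideConfig P Q' u w c g = true → G.fst g ≠ u' ∧ G.snd g ≠ u') ∧
      (∀ g, Function.update (G.sideConfig P Q' u w c) e true g = true →
        G.fst g ≠ u' ∧ G.snd g ≠ u') ∧
      ¬ G.Conn (G.sideConfig P Q' u w c) u c ∧
      G.Conn (Function.update (G.sideConfig P Q' u w c) e true) u c := by
  -- notation
  set Pw := G.awayFrom P w with hPw
  set A := G.cluster Pw u with hA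
  set C := G.cluster Q' c with hC
  have hPw_le : Pw ≤ P := awayFrom_le P w
  have hAW : ∀ y, y ∈ A → G.Conn P u y := fun y hy => Conn.mono hPw_le hy
  have hvC : v ∈ C := hcv
  have hvW : ¬ G.Conn P u v := hCW v hcv
  -- (C1) `u ↮ u'` once the edges at `w` are cut
  have hC1 : ¬ G.Conn Pw u u' := by
    intro hcon
    obtain ⟨g, hg, hgw⟩ := exists_open_edge_of_conn hw.symm hwu.symm
    have hle : Pw ≤ Function.update P g false := by
      intro g'
      rw [Bool.le_iff_imp]
      intro hg'
      rw [awayFrom_eq_true_iff] at hg'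
      have hne : g' ≠ g := by
        rintro rfl
        rcases hgw with h | h
        · exact hg'.2.1 h
        · exact hg'.2.2 h
      rw [Function.update_of_ne hne]
      exact hg'.1
    exact hPmin g hg (hcon.mono hle)
  -- (C2) `w ∉ A`
  have hC2 : w ∉ A := fun hcon =>
    hwu (conn_eq_of_no_open_edge (awayFrom_no_edge P w) hcon).symm
  -- cluster `A` is closed under the open edges of `Pw`
  have hAclosed : ∀ g, Pw g = true → (G.fst g ∈ A ↔ G.snd g ∈ A) := by
    intro g hg
    have hadj : G.Conn Pw (G.fst g) (G.snd g) := Conn.of_openAdj (G.openAdj_of_open g hg)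
    exact ⟨fun h => h.trans hadj, fun h => h.trans hadj.symm⟩
  -- (C3) an open edge of `P` joins `w` to `A`
  have hC3 : ∃ f x, P f = true ∧ x ∈ A ∧
      ((G.fst f = w ∧ G.snd f = x) ∨ (G.fst f = x ∧ G.snd f = w)) := by
    by_contra hno
    have hbd : ∀ g, P g = true → (G.fst g ∈ A ↔ G.snd g ∈ A) := by
      intro g hg
      by_cases h1 : G.fst g = w
      · have h2 : G.snd g ∉ A := fun h => hno ⟨g, G.snd g, hg, h, Or.inl ⟨h1, rfl⟩⟩
        rw [h1]
        exact ⟨fun h => absurd h hC2, fun h => absurd h h2⟩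
      · by_cases h2 : G.snd g = w
        · have h1' : G.fst g ∉ A := fun h => hno ⟨g, G.fst g, hg, h, Or.inr ⟨rfl, h2⟩⟩
          rw [h2]
          exact ⟨fun h => absurd h h1', fun h => absurd h hC2⟩
        · exact hAclosed g (awayFrom_eq_true_iff.2 ⟨hg, h1, h2⟩)
    have : u' ∈ A := mem_of_conn_of_closed_boundary hbd (Conn.refl G Pw u) hPuu'
    exact hC1 this
  obtain ⟨f, x, hf, hxA, hfend⟩ := hC3
  -- the two pieces
  have hdisj : Disjoint (A ∪ {w}) C := by
    rw [Set.disjoint_left]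
    rintro y (hy | hy) hyC
    · exact hCW y hyC (hAW y hy)
    · rw [Set.mem_singleton_iff] at hy
      exact hCW y hyC (hy ▸ hw)
  have hu'A : u' ∉ A ∪ {w} := by
    rintro (h | h)
    · exact hC1 h
    · exact hwu' (Set.mem_singleton_iff.1 h).symm
  have hu'C : u' ∉ C := fun h => hCW u' h hPuu'
  have hvu' : v ≠ u' := fun h => hvW (h ▸ hPuu')
  refine ⟨?_, ?_, ?_, ?_, ?_⟩
  · -- `e` is closed
    rw [sideConfig, sup_apply_eq_false_iff]
    exact ⟨restrictTo_eq_false_of_eq_false hPe _, restrictTo_eq_false_of_eq_false hQ'e _⟩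
  · -- `u'` isolated
    exact fun g hg => no_open_edge_sup_restrict P Q' hu'A hu'C g hg
  · -- `u'` isolated after opening `e`
    refine fun g hg => no_open_edge_sup_restrict_update P Q' hu'A hu'C ?_ ?_ g hg
    · rcases hend with ⟨h, _⟩ | ⟨h, _⟩
      · exact h ▸ hvu'
      · exact h ▸ hwu'
    · rcases hend with ⟨_, h⟩ | ⟨_, h⟩
      · exact h ▸ hwu'
      · exact h ▸ hvu'
  · -- `u ↮ c`
    intro hcon
    have hcX : c ∈ A ∪ {w} :=
      mem_of_conn_of_closed_boundary (closed_boundary_sup_restrict P Q' hdisj)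
        (Or.inl (Conn.refl G Pw u)) hcon
    rcases hcX with h | h
    · exact hPuc (hAW c h)
    · exact hPuc ((Set.mem_singleton_iff.1 h) ▸ hw)
  · -- `u ↔ c` after opening `e`
    have hux : G.Conn (G.restrictTo P (A ∪ {w})) u x := by
      refine conn_of_cluster_edges_open (fun g hg hfst => ?_) hxA
      rw [restrictTo_eq_true_iff]
      exact ⟨hPw_le g |> fun h => Bool.le_iff_imp.1 h hg, Or.inl hfst,
        Or.inl ((hAclosed g hg).1 hfst)⟩
    have hfopen : G.restrictTo P (A ∪ {w}) f = true := by
      rw [restrictTo_eq_true_iff]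
      rcases hfend with ⟨h1, h2⟩ | ⟨h1, h2⟩
      · exact ⟨hf, Or.inr (h1 ▸ rfl), Or.inl (h2 ▸ hxA)⟩
      · exact ⟨hf, Or.inl (h1 ▸ hxA), Or.inr (h2 ▸ rfl)⟩
    have hxw : G.Conn (G.restrictTo P (A ∪ {w})) x w :=
      Conn.of_openAdj ⟨f, hfopen, by
        rcases hfend with ⟨h1, h2⟩ | ⟨h1, h2⟩
        · exact Or.inr ⟨h1, h2⟩
        · exact Or.inl ⟨h1, h2⟩⟩
    have huw : G.Conn (G.sideConfig P Q' u w c) u w :=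
      (hux.trans hxw).mono le_sup_left
    have hcv' : G.Conn (G.sideConfig P Q' u w c) c v :=
      (conn_restrictTo_cluster hcv).mono le_sup_right
    have hwv : G.Conn (Function.update (G.sideConfig P Q' u w c) e true) w v :=
      conn_update_true_of_endpoints _ hend
    exact ((huw.mono (le_update_true _ _)).trans hwv).trans
      (hcv'.mono (le_update_true _ _)).symm

end Side


/-! ### The endpoint cases -/

section Endpoint

variable [DecidableEq E]

/-- The join of the `u`-cluster of `P` with the `c`-cluster of `Q'`. -/
noncomputable def joinConfig (G : MultiGraph V E) (P Q' : Config E) (u c : V) : Config E :=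
  G.restrictTo P (G.cluster P u) ⊔ G.restrictTo Q' (G.cluster Q' c)

/-- **The main configuration.**  If `u ↔ u'` and `u ↮ c` in `P`, the `c`-cluster of `Q'` avoids
the `u`-cluster of `P` and contains `v`, and `e = {v, w}` is closed in both, then in
`η = joinConfig P Q' u c`: `e` is closed, `u ↔ u'`, `u ↮ c`, and after opening `e`, `w ↔ c`. -/
theorem joinConfig_spec {P Q' : Config E} {u u' w v c : V} {e : E}
    (hPuu' : G.Conn P u u') (hPuc : ¬ G.Conn P u c)
    (hCW : ∀ y, G.Conn Q' c y → ¬ G.Conn P u y) (hcv : G.Conn Q' c v) (hQ'e : Q' e = false)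
    (hPe : P e = false) (hend : (G.fst e = v ∧ G.snd e = w) ∨ (G.fst e = w ∧ G.snd e = v)) :
    G.joinConfig P Q' u c e = false ∧ G.Conn (G.joinConfig P Q' u c) u u' ∧
      ¬ G.Conn (G.joinConfig P Q' u c) u c ∧
      G.Conn (Function.update (G.joinConfig P Q' u c) e true) w c := by
  have hdisj : Disjoint (G.cluster P u) (G.cluster Q' c) := by
    rw [Set.disjoint_left]
    intro y hy hyC
    exact hCW y hyC hy
  refine ⟨?_, ?_, ?_, ?_⟩
  · rw [joinConfig, sup_apply_eq_false_iff]
    exact ⟨restrictTo_eq_false_of_eq_false hPe _, restrictTo_eq_false_of_eq_false hQ'e _⟩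
  · exact (conn_restrictTo_cluster hPuu').mono le_sup_left
  · intro hcon
    exact hPuc (mem_of_conn_of_closed_boundary (closed_boundary_sup_restrict P Q' hdisj)
      (Conn.refl G P u) hcon)
  · have hwv := conn_update_true_of_endpoints (G.joinConfig P Q' u c) hend
    have hvc : G.Conn (G.joinConfig P Q' u c) v c :=
      ((conn_restrictTo_cluster hcv).mono le_sup_right).symm
    exact hwv.trans (hvc.mono (le_update_true _ _))

/-- **The third configuration.**  If `s ↔ c` and `s ↮ u` in `S`, `u` is not in the `c`-cluster of
`Q'`, which contains `v`, and `e = {v, u}` is closed in `Q'`, then in `η' = joinConfig S Q' s c`: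
`e` is closed, `u` is isolated, `s ↔ c`, and after opening `e`, `u ↔ c`. -/
theorem joinConfig_third_spec {S Q' : Config E} {s u v c : V} {e : E}
    (hSsc : G.Conn S s c) (hSsu : ¬ G.Conn S s u) (hQu : ¬ G.Conn Q' c u)
    (hcv : G.Conn Q' c v) (hQ'e : Q' e = false)
    (hend : (G.fst e = v ∧ G.snd e = u) ∨ (G.fst e = u ∧ G.snd e = v)) :
    G.joinConfig S Q' s c e = false ∧
      (∀ g, G.joinConfig S Q' s c g = true → G.fst g ≠ u ∧ G.snd g ≠ u) ∧
      G.Conn (G.joinConfig S Q' s c) s c ∧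
      G.Conn (Function.update (G.joinConfig S Q' s c) e true) u c := by
  have huS : u ∉ G.cluster S s := hSsu
  have huC : u ∉ G.cluster Q' c := hQu
  refine ⟨?_, ?_, ?_, ?_⟩
  · rw [joinConfig, sup_apply_eq_false_iff]
    refine ⟨?_, restrictTo_eq_false_of_eq_false hQ'e _⟩
    rcases hend with ⟨_, h⟩ | ⟨h, _⟩
    · exact restrictTo_eq_false_of_snd_notMem (by rw [h]; exact huS)
    · exact restrictTo_eq_false_of_fst_notMem (by rw [h]; exact huS)
  · exact fun g hg => no_open_edge_sup_restrict S Q' huS huC g hg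
  · exact (conn_restrictTo_cluster hSsc).mono le_sup_left
  · have huv := conn_update_true_of_endpoints (G.joinConfig S Q' s c) hend
    have hvc : G.Conn (G.joinConfig S Q' s c) v c :=
      ((conn_restrictTo_cluster hcv).mono le_sup_right).symm
    exact huv.trans (hvc.mono (le_update_true _ _))

end Endpoint

end MultiGraph

end PercRepro
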